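import Mathlib
import Summits.ValiantsHypothesis.ValiantsHypothesis.Theorems.DivisionGapPerMultiplesHardStubCodegreeDeviationAux

/-!
# Crux `DivisionGap.PerMultiplesHard` (stmt-ValiantsHypothesis-5068), line `uncharged-face-walk` —
# stub `stub_codegreeDeviation`: codegree deviation of a dense regular block (lead c9, cycle 9)

**Theorem (`stub_codegreeDeviation`).** For all `Dd, D₃ ≥ 1` there are `P ≥ 1` and `a₀` such that
for every `a ≥ a₀` and every block `X' ⊆ Fin a × Fin a` (rows `e.1`, columns `e.2`) that is dense
(`a² ≤ Dd · #X'`) and `1/P`-regular on the whole board (every row set `S` and column set `T` with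
`a ≤ P · #S`, `a ≤ P · #T` span a density within `1/P` of `p := #X'/a²`) there are a typical row
codegree `c₂ ≤ a` and a typical 4-wise row intersection `c₄` with `#X'² ≤ (c₂ + 1) a³`,
`D₃ · Σ_{x ≠ x'} |codeg (x, x') − c₂| ≤ a³`, `D₃ · Σ_{x₁, x₂, x₃, x₄ distinct} |quad − c₄| ≤ a⁵`
and `D₃ · |c₄ a − c₂²| ≤ a²`.

## Proof [folklore]

Take `P := 64 D₃ Dd³`, `a₀ := 2 D₃`, `ε := 1/P`, `c₂ := ⌊p² a⌋₊`, `c₄ := ⌊p⁴ a⌋₊`.  The auxiliary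
file `DivisionGapPerMultiplesHardStubCodegreeDeviationAux` supplies the key lemma `exists_bad_rows`
(one application of regularity: for a column set `Y` with `a ≤ P · #Y` fewer than `2a/P` rows have
degree into `Y` outside `[(p − ε) #Y, (p + ε) #Y]`) and the first two levels of the chain
`Y₀ = univ`, `Y_{i+1} = Y_i ∩ N(x_{i+1})`; here `level_three`, `level_four` finish the chain
(typical steps keep `#Y_i ∈ [(p − ε)^i a, (p + ε)^i a]`, the last degree is within `15 ε a + 1`
of `⌊p^m a⌋₊`, every term is `≤ a`, fewer than `2 ε a` rows are atypical per level), giving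
`Σ₂ ≤ 19 ε a³ + a²` and `Σ₄ ≤ 23 ε a⁵ + a⁴`; with `D₃ ε ≤ 1/64` and `a ≥ 2 D₃` these are
`≤ a³/D₃`, `≤ a⁵/D₃`.  The floors give `#X'² = (p² a) a³ < (c₂ + 1) a³` and `|c₄ a − c₂²| ≤ 2a`.

Leans on the auxiliary file and Mathlib only.  No definitions.
-/

noncomputable section

-- `Summit.ValiantsHypothesis.ValiantsHypothesis.…` is the tree's mandated single-conjunct layout
-- (Sub = Summit), so the duplicated namespace component is intended.
set_option linter.dupNamespace false

namespace Summit.ValiantsHypothesis.ValiantsHypothesis.Theorems.DivisionGap.PerMultiplesHard.CodegreeDeviation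

open Finset
open scoped BigOperators

/-! ### The last two levels of the chain `Y₀ = univ ⊇ Y₁ = N(x₁) ⊇ Y₂ = Y₁ ∩ N(x₂) ⊇ ⋯` -/

/-- Level 3 (one level above `level_two` of the auxiliary file): triple sums from a column set `Y`
with `#Y ∈ [(p - ε)^k a, (p + ε)^k a]` and `c ∈ (p^m a - 1, p^m a]`, `m = k + 3`. [folklore] -/
theorem level_three {a P k m : ℕ} {X' : Finset (Fin a × Fin a)} {p ε c : ℝ} (ha : 1 ≤ a)
    (hreg : ∀ S T : Finset (Fin a), a ≤ P * S.card → a ≤ P * T.card →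
      |(((X'.filter fun e => e.1 ∈ S ∧ e.2 ∈ T).card : ℕ) : ℝ) / ((S.card : ℝ) * (T.card : ℝ)) -
        p| ≤ ε)
    (hPε : (P : ℝ) * ε = 1) (hε0 : 0 ≤ ε) (hεp : ε ≤ p) (hp1 : p ≤ 1)
    (hPq : 1 ≤ (P : ℝ) * (p - ε) ^ 3) (hk : k + 2 ≤ 3) (hm : m = k + 3)
    (h15 : (p + ε) ^ m ≤ p ^ m + 15 * ε) (h15' : p ^ m ≤ (p - ε) ^ m + 15 * ε)
    (hc0 : 0 ≤ c) (hca : c ≤ a) (hc1 : c ≤ p ^ m * a) (hc2 : p ^ m * a < c + 1)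
    (Y : Finset (Fin a)) (hlo : (p - ε) ^ k * a ≤ Y.card) (hhi : (Y.card : ℝ) ≤ (p + ε) ^ k * a)
    (s : Finset (Fin a)) (t : Fin a → Finset (Fin a)) (u : Fin a → Fin a → Finset (Fin a)) :
    ∑ x ∈ s, ∑ x' ∈ t x, ∑ x'' ∈ u x x',
        |((((Y.filter fun y => (x, y) ∈ X').filter fun y => (x', y) ∈ X').filter
            fun y => (x'', y) ∈ X').card : ℝ) - c| ≤
      a * (a * (a * (15 * ε * a + 1) + 2 * ε * a * a) + 2 * ε * a * (a * a)) +
        2 * ε * a * (a * (a * a)) := by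
  have hq0 : 0 ≤ p - ε := sub_nonneg.2 hεp
  have hq1 : p - ε ≤ 1 := by linarith
  obtain ⟨B, hB, hBtyp⟩ :=
    exists_bad_rows ha hreg Y (side_le_of_le_card (le_trans (by omega) hk) hq0 hq1 hPq hlo)
  have hBε : (B.card : ℝ) ≤ 2 * ε * a :=
    calc (B.card : ℝ) = ε * ((P : ℝ) * B.card) := by rw [← mul_assoc, mul_comm ε, hPε, one_mul]
      _ ≤ ε * (2 * a) := mul_le_mul_of_nonneg_left hB.le hε0
      _ = 2 * ε * a := by ring
  refine sum_le_of_typical s B _ (by positivity) (by positivity) (card_le_side s) hBε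
    (fun x _ => sum_le_side_mul (t x) _ (by positivity) fun x' _ =>
      sum_le_side_mul (u x x') _ (Nat.cast_nonneg a) fun x'' _ =>
        abs_degree_sub_le X' ((Y.filter fun y => (x, y) ∈ X').filter fun y => (x', y) ∈ X')
          x'' hc0 hca)
    fun x _ hx => ?_
  obtain ⟨hdlo, hdhi⟩ := hBtyp x hx
  obtain ⟨hlo', hhi'⟩ := window_succ hq0 (by linarith) hlo hhi hdlo hdhi
  exact level_two (k := k + 1) (m := m) ha hreg hPε hε0 hεp hp1 hPq (by omega) (by omega) h15
    h15' hc0 hca hc1 hc2 (Y.filter fun y => (x, y) ∈ X') hlo' hhi' (t x) (u x)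

/-- Level 4 (outermost, `Y = Y₀` of size `a`). The quadruple sum of the deviations of the 4-wise
row intersections inside `Y` from `c ∈ (p⁴ a - 1, p⁴ a]` is at most `23 ε a⁵ + a⁴`. [folklore] -/
theorem level_four {a P : ℕ} {X' : Finset (Fin a × Fin a)} {p ε c : ℝ} (ha : 1 ≤ a)
    (hreg : ∀ S T : Finset (Fin a), a ≤ P * S.card → a ≤ P * T.card →
      |(((X'.filter fun e => e.1 ∈ S ∧ e.2 ∈ T).card : ℕ) : ℝ) / ((S.card : ℝ) * (T.card : ℝ)) -
        p| ≤ ε)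
    (hPε : (P : ℝ) * ε = 1) (hε0 : 0 ≤ ε) (hεp : ε ≤ p) (hp1 : p ≤ 1)
    (hPq : 1 ≤ (P : ℝ) * (p - ε) ^ 3)
    (h15 : (p + ε) ^ 4 ≤ p ^ 4 + 15 * ε) (h15' : p ^ 4 ≤ (p - ε) ^ 4 + 15 * ε)
    (hc0 : 0 ≤ c) (hca : c ≤ a) (hc1 : c ≤ p ^ 4 * a) (hc2 : p ^ 4 * a < c + 1)
    (Y : Finset (Fin a)) (hlo : (p - ε) ^ 0 * a ≤ Y.card) (hhi : (Y.card : ℝ) ≤ (p + ε) ^ 0 * a)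
    (s : Finset (Fin a)) (t : Fin a → Finset (Fin a)) (u : Fin a → Fin a → Finset (Fin a))
    (v : Fin a → Fin a → Fin a → Finset (Fin a)) :
    ∑ x₁ ∈ s, ∑ x₂ ∈ t x₁, ∑ x₃ ∈ u x₁ x₂, ∑ x₄ ∈ v x₁ x₂ x₃,
        |(((((Y.filter fun y => (x₁, y) ∈ X').filter fun y => (x₂, y) ∈ X').filter
            fun y => (x₃, y) ∈ X').filter fun y => (x₄, y) ∈ X').card : ℝ) - c| ≤
      a * (a * (a * (a * (15 * ε * a + 1) + 2 * ε * a * a) + 2 * ε * a * (a * a)) +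
        2 * ε * a * (a * (a * a))) + 2 * ε * a * (a * (a * (a * a))) := by
  have hq0 : 0 ≤ p - ε := sub_nonneg.2 hεp
  have hq1 : p - ε ≤ 1 := by linarith
  obtain ⟨B, hB, hBtyp⟩ :=
    exists_bad_rows ha hreg Y (side_le_of_le_card (k := 0) (by norm_num) hq0 hq1 hPq hlo)
  have hBε : (B.card : ℝ) ≤ 2 * ε * a :=
    calc (B.card : ℝ) = ε * ((P : ℝ) * B.card) := by rw [← mul_assoc, mul_comm ε, hPε, one_mul]
      _ ≤ ε * (2 * a) := mul_le_mul_of_nonneg_left hB.le hε0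
      _ = 2 * ε * a := by ring
  refine sum_le_of_typical s B _ (by positivity) (by positivity) (card_le_side s) hBε
    (fun x₁ _ => sum_le_side_mul (t x₁) _ (by positivity) fun x₂ _ =>
      sum_le_side_mul (u x₁ x₂) _ (by positivity) fun x₃ _ =>
        sum_le_side_mul (v x₁ x₂ x₃) _ (Nat.cast_nonneg a) fun x₄ _ =>
          abs_degree_sub_le X' (((Y.filter fun y => (x₁, y) ∈ X').filter
            fun y => (x₂, y) ∈ X').filter fun y => (x₃, y) ∈ X') x₄ hc0 hca)
    fun x₁ _ hx => ?_
  obtain ⟨hdlo, hdhi⟩ := hBtyp x₁ hx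
  obtain ⟨hlo', hhi'⟩ := window_succ hq0 (by linarith) hlo hhi hdlo hdhi
  exact level_three (k := 1) (m := 4) ha hreg hPε hε0 hεp hp1 hPq (by norm_num) (by norm_num)
    h15 h15' hc0 hca hc1 hc2 (Y.filter fun y => (x₁, y) ∈ X') hlo' hhi' (t x₁) (u x₁) (v x₁)

/-! ### Assembly -/

/-- **`stub_codegreeDeviation`** (hypothesis (H2) of the tree theorem `stub_orderedFactor`, line
`uncharged-face-walk`): a dense `1/P`-regular block has a typical row codegree `c₂ = ⌊p² a⌋₊` and
a typical 4-wise row intersection `c₄ = ⌊p⁴ a⌋₊` whose `ℓ¹` deviation sums are `≤ a³/D₃` and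
`≤ a⁵/D₃`, with `#X'² ≤ (c₂ + 1) a³` and `D₃ |c₄ a − c₂²| ≤ a²`; here `P = 64 D₃ Dd³` and
`a₀ = 2 D₃`.  Route: `exists_bad_rows` iterated along the chain of common neighbourhoods
(`level_two` from `Y₀ = univ` for the codegrees, `level_four` for the 4-wise intersections), then
the floor estimates. [folklore] -/
theorem stub_codegreeDeviation :
    ∀ Dd D₃ : ℕ, 1 ≤ Dd → 1 ≤ D₃ → ∃ P a₀ : ℕ, 1 ≤ P ∧ ∀ a ≥ a₀, ∀ X' : Finset (Fin a × Fin a),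
      a * a ≤ Dd * X'.card →
      (∀ S T : Finset (Fin a), a ≤ P * S.card → a ≤ P * T.card →
        |(((X'.filter fun e => e.1 ∈ S ∧ e.2 ∈ T).card : ℕ) : ℝ) / ((S.card : ℝ) * (T.card : ℝ)) -
          ((X'.card : ℕ) : ℝ) / ((a : ℝ) * (a : ℝ))| ≤ 1 / (P : ℝ)) →
      ∃ c₂ c₄ : ℕ, c₂ ≤ a ∧ ((X'.card : ℕ) : ℝ) ^ 2 ≤ ((c₂ : ℝ) + 1) * (a : ℝ) ^ 3 ∧
        (D₃ : ℝ) * (∑ x : Fin a, ∑ x' ∈ Finset.univ.erase x,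
            |(((Finset.univ.filter fun y : Fin a => (x, y) ∈ X' ∧ (x', y) ∈ X').card : ℕ) : ℝ) -
              c₂|) ≤ (a : ℝ) ^ 3 ∧
        (D₃ : ℝ) * (∑ x₁ : Fin a, ∑ x₂ ∈ Finset.univ.erase x₁,
            ∑ x₃ ∈ (Finset.univ.erase x₁).erase x₂,
            ∑ x₄ ∈ ((Finset.univ.erase x₁).erase x₂).erase x₃,
            |(((Finset.univ.filter fun y : Fin a =>
                (x₁, y) ∈ X' ∧ (x₂, y) ∈ X' ∧ (x₃, y) ∈ X' ∧ (x₄, y) ∈ X').card : ℕ) : ℝ) -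
              c₄|) ≤ (a : ℝ) ^ 5 ∧
        (D₃ : ℝ) * |(c₄ : ℝ) * a - (c₂ : ℝ) ^ 2| ≤ (a : ℝ) ^ 2 := by
  intro Dd D₃ hDd hD₃
  obtain ⟨P, hP⟩ : ∃ P : ℕ, P = 64 * D₃ * Dd ^ 3 := ⟨_, rfl⟩
  have hP1 : 1 ≤ P := by
    rw [hP]
    calc 1 = 1 * 1 * 1 := by norm_num
      _ ≤ 64 * D₃ * Dd ^ 3 :=
        Nat.mul_le_mul (Nat.mul_le_mul (by norm_num) hD₃) (Nat.one_le_pow _ _ (by omega))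
  refine ⟨P, 2 * D₃, hP1, ?_⟩
  intro a ha X' hdense hreg
  -- the parameters over `ℝ`
  have hPr : (P : ℝ) = 64 * D₃ * (Dd : ℝ) ^ 3 := by rw [hP]; norm_cast
  have hD₃r : (1 : ℝ) ≤ D₃ := by exact_mod_cast hD₃
  have hDdr : (1 : ℝ) ≤ Dd := by exact_mod_cast hDd
  have ha2 : 2 * (D₃ : ℝ) ≤ a := by exact_mod_cast ha
  have ha1 : 1 ≤ a := by omega
  have ha0 : (0 : ℝ) ≤ a := Nat.cast_nonneg a
  have hP0 : (0 : ℝ) < P := by rw [hPr]; positivity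
  have haa : (0 : ℝ) < (a : ℝ) * a := by positivity
  -- the density `p` and the accuracy `ε`
  obtain ⟨p, hp⟩ : ∃ p : ℝ, p = ((X'.card : ℕ) : ℝ) / ((a : ℝ) * (a : ℝ)) := ⟨_, rfl⟩
  obtain ⟨ε, hε⟩ : ∃ ε : ℝ, ε = 1 / (P : ℝ) := ⟨_, rfl⟩
  rw [← hp, ← hε] at hreg
  have hcard : (X'.card : ℝ) ≤ (a : ℝ) * a := by
    have h := Finset.card_le_univ X'
    rw [Fintype.card_prod, Fintype.card_fin] at h
    exact_mod_cast h
  have hdense' : (a : ℝ) * a ≤ Dd * X'.card := by exact_mod_cast hdense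
  have hp1 : p ≤ 1 := by rw [hp, div_le_one haa]; exact hcard
  have hpD : 1 / (Dd : ℝ) ≤ p := by
    rw [hp, div_le_div_iff₀ (by positivity) haa, one_mul]
    linarith
  have hp0 : 0 < p := lt_of_lt_of_le (by positivity) hpD
  have hPε : (P : ℝ) * ε = 1 := by rw [hε]; field_simp
  have hε0 : 0 < ε := by rw [hε]; positivity
  have hPDd : 2 * (Dd : ℝ) ≤ P := by
    rw [hPr]
    have h1 : (Dd : ℝ) ≤ (Dd : ℝ) ^ 3 := by
      calc (Dd : ℝ) = (Dd : ℝ) ^ 1 := (pow_one _).symm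
        _ ≤ (Dd : ℝ) ^ 3 := pow_le_pow_right₀ hDdr (by norm_num)
    have h2 : 1 * (64 * (Dd : ℝ) ^ 3) ≤ D₃ * (64 * (Dd : ℝ) ^ 3) :=
      mul_le_mul_of_nonneg_right hD₃r (by positivity)
    linarith
  have hε2 : 2 * ε ≤ 1 / Dd := by
    rw [hε, mul_one_div, div_le_div_iff₀ hP0 (by positivity), one_mul]
    exact hPDd
  have hεp : ε ≤ p := by linarith
  have hq : 1 / (Dd : ℝ) / 2 ≤ p - ε := by linarith
  have hPq : 1 ≤ (P : ℝ) * (p - ε) ^ 3 := by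
    have h1 : (1 / (Dd : ℝ) / 2) ^ 3 ≤ (p - ε) ^ 3 := pow_le_pow_left₀ (by positivity) hq 3
    have h2 : (P : ℝ) * (1 / (Dd : ℝ) / 2) ^ 3 = 8 * D₃ := by
      rw [hPr]
      field_simp
      ring
    calc (1 : ℝ) ≤ 8 * D₃ := by linarith
      _ = (P : ℝ) * (1 / (Dd : ℝ) / 2) ^ 3 := h2.symm
      _ ≤ (P : ℝ) * (p - ε) ^ 3 := mul_le_mul_of_nonneg_left h1 hP0.le
  obtain ⟨h15, h15'⟩ := window_two hε0.le hεp hp1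
  obtain ⟨h45, h45'⟩ := window_four hε0.le hεp hp1
  -- the typical values
  obtain ⟨c₂, hc₂⟩ : ∃ c₂ : ℕ, c₂ = ⌊p ^ 2 * a⌋₊ := ⟨_, rfl⟩
  obtain ⟨c₄, hc₄⟩ : ∃ c₄ : ℕ, c₄ = ⌊p ^ 4 * a⌋₊ := ⟨_, rfl⟩
  have hc₂le : (c₂ : ℝ) ≤ p ^ 2 * a := by rw [hc₂]; exact Nat.floor_le (by positivity)
  have hc₂lt : p ^ 2 * a < c₂ + 1 := by rw [hc₂]; exact Nat.lt_floor_add_one _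
  have hc₄le : (c₄ : ℝ) ≤ p ^ 4 * a := by rw [hc₄]; exact Nat.floor_le (by positivity)
  have hc₄lt : p ^ 4 * a < c₄ + 1 := by rw [hc₄]; exact Nat.lt_floor_add_one _
  have hp2a : p ^ 2 * a ≤ a := mul_le_of_le_one_left ha0 (pow_le_one₀ hp0.le hp1)
  have hp4a : p ^ 4 * a ≤ a := mul_le_of_le_one_left ha0 (pow_le_one₀ hp0.le hp1)
  have hc₂a : (c₂ : ℝ) ≤ a := hc₂le.trans hp2a
  have hc₄a : (c₄ : ℝ) ≤ a := hc₄le.trans hp4a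
  have hD₃ε : (D₃ : ℝ) * ε ≤ 1 / 64 := by
    rw [hε, mul_one_div, div_le_div_iff₀ hP0 (by norm_num), one_mul, hPr]
    have h1 : (1 : ℝ) ≤ (Dd : ℝ) ^ 3 := one_le_pow₀ hDdr
    linarith [mul_le_mul_of_nonneg_left h1 (by positivity : (0 : ℝ) ≤ 64 * D₃)]
  have huniv_lo : (p - ε) ^ 0 * a ≤ ((Finset.univ : Finset (Fin a)).card : ℝ) := by
    rw [Finset.card_univ, Fintype.card_fin, pow_zero, one_mul]
  have huniv_hi : ((Finset.univ : Finset (Fin a)).card : ℝ) ≤ (p + ε) ^ 0 * a := by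
    rw [Finset.card_univ, Fintype.card_fin, pow_zero, one_mul]
  refine ⟨c₂, c₄, by exact_mod_cast hc₂a, ?_, ?_, ?_, ?_⟩
  · -- `#X'² = (p² a) a³ < (c₂ + 1) a³`
    have hX : (X'.card : ℝ) = p * ((a : ℝ) * a) := by rw [hp, div_mul_cancel₀ _ haa.ne']
    have h1 : ((X'.card : ℕ) : ℝ) ^ 2 = p ^ 2 * a * (a : ℝ) ^ 3 := by rw [hX]; ring
    rw [h1]
    exact mul_le_mul_of_nonneg_right hc₂lt.le (by positivity)
  · -- codegrees: `level_two` from `Y₀ = univ`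
    have h2 := level_two (k := 0) (m := 2) ha1 hreg hPε hε0.le hεp hp1 hPq (by norm_num)
      (by norm_num) h15 h15' (Nat.cast_nonneg c₂) hc₂a hc₂le hc₂lt Finset.univ huniv_lo huniv_hi
      Finset.univ fun x => Finset.univ.erase x
    simp only [Finset.filter_filter] at h2
    have h3 : (D₃ : ℝ) * (a * (a * (15 * ε * a + 1) + 2 * ε * a * a) + 2 * ε * a * (a * a)) ≤
        (a : ℝ) ^ 3 := by
      have e1 : (D₃ : ℝ) * (a * (a * (15 * ε * a + 1) + 2 * ε * a * a) + 2 * ε * a * (a * a)) =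
          19 * ((D₃ : ℝ) * ε) * (a : ℝ) ^ 3 + D₃ * (a : ℝ) ^ 2 := by ring
      rw [e1]
      have h4 : (D₃ : ℝ) * (a : ℝ) ^ 2 ≤ (a : ℝ) ^ 3 / 2 := by
        have := mul_le_mul_of_nonneg_right ha2 (sq_nonneg (a : ℝ))
        linarith
      have h5 : 19 * ((D₃ : ℝ) * ε) * (a : ℝ) ^ 3 ≤ 19 * (1 / 64) * (a : ℝ) ^ 3 := by gcongr
      linarith [pow_nonneg ha0 3]
    exact (mul_le_mul_of_nonneg_left h2 (Nat.cast_nonneg D₃)).trans h3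
  · -- 4-wise intersections: `level_four` from `Y₀ = univ`
    have h4 := level_four ha1 hreg hPε hε0.le hεp hp1 hPq h45 h45' (Nat.cast_nonneg c₄) hc₄a
      hc₄le hc₄lt Finset.univ huniv_lo huniv_hi Finset.univ (fun x₁ => Finset.univ.erase x₁)
      (fun x₁ x₂ => (Finset.univ.erase x₁).erase x₂)
      fun x₁ x₂ x₃ => ((Finset.univ.erase x₁).erase x₂).erase x₃
    simp only [Finset.filter_filter, and_assoc] at h4
    have h3 : (D₃ : ℝ) * (a * (a * (a * (a * (15 * ε * a + 1) + 2 * ε * a * a) +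
        2 * ε * a * (a * a)) + 2 * ε * a * (a * (a * a))) + 2 * ε * a * (a * (a * (a * a)))) ≤
        (a : ℝ) ^ 5 := by
      have e1 : (D₃ : ℝ) * (a * (a * (a * (a * (15 * ε * a + 1) + 2 * ε * a * a) +
          2 * ε * a * (a * a)) + 2 * ε * a * (a * (a * a))) + 2 * ε * a * (a * (a * (a * a)))) =
          23 * ((D₃ : ℝ) * ε) * (a : ℝ) ^ 5 + D₃ * (a : ℝ) ^ 4 := by ring
      rw [e1]
      have h5 : (D₃ : ℝ) * (a : ℝ) ^ 4 ≤ (a : ℝ) ^ 5 / 2 := by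
        have := mul_le_mul_of_nonneg_right ha2 (pow_nonneg ha0 4)
        linarith
      have h6 : 23 * ((D₃ : ℝ) * ε) * (a : ℝ) ^ 5 ≤ 23 * (1 / 64) * (a : ℝ) ^ 5 := by gcongr
      linarith [pow_nonneg ha0 5]
    exact (mul_le_mul_of_nonneg_left h4 (Nat.cast_nonneg D₃)).trans h3
  · -- `|c₄ a − c₂²| ≤ 2a`
    have hc₂0 : (0 : ℝ) ≤ c₂ := Nat.cast_nonneg _
    have hkey : 0 ≤ ((c₂ : ℝ) - p ^ 2 * a + 1) * (c₂ + p ^ 2 * a) :=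
      mul_nonneg (by linarith) (by positivity)
    have h1 : p ^ 4 * a * a ≤ ((c₄ : ℝ) + 1) * a := by
      have := mul_le_mul_of_nonneg_right hc₄lt.le ha0
      linarith
    have h2 : (c₄ : ℝ) * a ≤ p ^ 4 * a * a := mul_le_mul_of_nonneg_right hc₄le ha0
    have h3 : (c₂ : ℝ) ^ 2 ≤ (p ^ 2 * a) ^ 2 := pow_le_pow_left₀ hc₂0 hc₂le 2
    have habs : |(c₄ : ℝ) * a - (c₂ : ℝ) ^ 2| ≤ 2 * a := by
      rw [abs_sub_le_iff]
      constructor <;> linarith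
    calc (D₃ : ℝ) * |(c₄ : ℝ) * a - (c₂ : ℝ) ^ 2| ≤ D₃ * (2 * a) :=
          mul_le_mul_of_nonneg_left habs (Nat.cast_nonneg D₃)
      _ = 2 * (D₃ : ℝ) * a := by ring
      _ ≤ a * a := mul_le_mul_of_nonneg_right ha2 ha0
      _ = (a : ℝ) ^ 2 := by ring

end Summit.ValiantsHypothesis.ValiantsHypothesis.Theorems.DivisionGap.PerMultiplesHard.CodegreeDeviation
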